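import Literature.IUT.HodgeTheaters.TemperedCoveringsCor23OfSpecialFibreDecompGraphic
import Literature.AnabelianGeometry.SemiGraphs.TemperedSpecialFibreTowerPiDataInduces
import HarnessLib

/-!
# [IUTchI] Cor. 2.3 (i)–(v) at the record's sub-semi-graph `ℍ` with the ORIGIN DATUM (P2′) `P.ActGraphInduces` BY NAME and
# the finiteness side conditions DISCHARGED from the record (row «COR23-P4-HSTAB-GENERAL», final consumer form)

Mochizuki, *Inter-universal Teichmüller theory I: construction of Hodge theaters*, kurims manuscript (May 2020), §2 p. 47
l. 22–24, Cor. 2.3 (i)–(v) pp. 47–48, proof pp. 48–50 [cite: Mochizuki2012, Cor 2.3 pp.47-50] (D-0012 claim key; series status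
DISPUTED; nothing of the series is asserted here; the [IUTchI] items are `[claim: Mochizuki2012, status: disputed]`);
Mochizuki, *Semi-graphs of anabelioids*, Publ. RIMS **42** (2006), Ex. 3.10 p. 44, Prop. 3.6 (iv) p. 39
[cite: MochizukiSemiAnbd2006, Ex 3.10 p.44].

PROOF-ONLY sequel (abc-iut cell; seat abc-iut-w4-d052 gen 6; L3-lead γ32/γ38, L5-lead RULINGS #104/#105) of
`TemperedCoveringsCor23OfSpecialFibreDecompGraphic.lean` (p484261), whose graphicity hypothesis `hgr` is now the landed
ORIGIN DATUM **`SpecialFibreTower.PiData.ActGraphInduces`** (`TemperedSpecialFibreTowerPiDataInduces.lean`, p484597;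
policy-D successor of abc-iut-L3-t2's `PiData`): the same closers with the binder displayed BY NAME as
`(hind : P.ActGraphInduces)` (definitionally the displayed `hgr` — `actGraphInduces_iff` is `Iff.rfl`), and with the
finiteness side conditions `[Finite S.Gc.graph.Vertex/Edge]` of the (v)/(iv) closers DISCHARGED from the record's own
field `P.finite : FiniteLevels` (`finite_vertex_base`, `finite_edge_base`).

* `hHstab_of_mem_decompSubgroups_of_actGraphInduces (P) (hind) (hTpH)`;
* `cor23_i_to_v_ofSpecialFibre_closureH_of_piData_of_mem_decompSubgroups_of_actGraphInduces (P) (hA) (hB) (hcoh) (hTpH)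
  (hind)` — rows (i)–(v) at the genuine datum, `ℍ := P.H`, every `Π^tp_ℍ ∈ decompSubgroups S.chart P.H`;
* `…_of_actGraphInduces_of_finite (P) (hfin : Σ.Finite) (hA) (hcoh) (hTpH) (hind)` — the IUT case `Σ = {l}`: `hB` idle
  (`cor23iii_condA_of_condB`, `exists_prime_not_mem_of_finite`, abc-iut-L5's `TemperedCoveringsCor23KerLevelOfTower`).

BINDER CENSUS (classes of L5-lead RULINGS #101 (2)) for the (i)–(v) headline: DATA = `X`, `d`, `S`, `Σ`/`Σ̂` + `hsub`/`hne`/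
`hprime`/`hp`, `TpH`, `hTpH : TpH ∈ S.chart.decompSubgroups P.H`, `cuspMeetsH`, `T`, `P` (supplying `ℍ := P.H`, `P.H_connected`,
`P.H_stable`, `P.baseVertex_mem`, `P.finite`) · DATUM-INTERNAL = `h36`, `S.hyp`, **`hind : P.ActGraphInduces`** (origin datum
(P2′), print p. 47 l. 22–24 / [SemiAnbd] Ex. 3.10 p. 44; its derivation from [SemiAnbd] Cor. 3.9 is the BANKED L3 row
«COR39-INSTANCE-AUTOFCONJ») · FACT-INSTANCE = `hcoh : S.Gc.IsCoherent` ([SemiAnbd] Ex. 2.10 coherence of `G^c`; used by (v)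
only) · LAW = `hA`, `hB` (the (a)/(b) centraliser laws feeding Cor. 2.3 (iii); finite `Σ`: `hA` only).  GONE versus abc-iut-w5-d028's
parametric (α) list `{h22, hHstab, hA, hB, hv}`: `h22` (htp/hhat theorems), `hHstab` (this chain), `hv` ((P1) + case split).
Model-RELATIVE; typed ≠ discharged; no definition, no instance, no new `Prop` fact; nothing here bears on [IUTchIII] Cor. 3.12
or asserts that abc is proved or refuted.
-/

noncomputable section

namespace Literature.IUT.HodgeTheaters

open _root_.Topology
open scoped Pointwise
open Literature.AnabelianGeometry.SemiGraphs
open Literature.AnabelianGeometry.AbsoluteAnabelian (IsCommensurablyTerminal)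

namespace StableCurveTemperedData

/-! ### A. `hHstab` from the origin datum, by name -/

section Stab

variable {p : ℕ} [Fact p.Prime] (X : TemperedCurve p) (d : X.GroupLevelData)
  (S : SpecialFibreData (X.toTemperedArithmeticGroup d)) (TpH : Subgroup S.chart.G)
  (T : SpecialFibreTower X.DeltaTemp)

/-- **`hHstab` for every decomposition group of the record's `ℍ`, from the ORIGIN DATUM `P.ActGraphInduces`** (the hypothesis
`hgr` of `hHstab_of_mem_decompSubgroups_of_graphic` IS the datum, definitionally). [cite: Mochizuki2012, Cor 2.3(i) p.47] -/
theorem hHstab_of_mem_decompSubgroups_of_actGraphInduces (P : SpecialFibreTower.PiData X d S T)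
    (hind : P.ActGraphInduces) (hTpH : TpH ∈ S.chart.decompSubgroups P.H) :
    ∀ g : X.PiTemp, ∃ t : S.chart.G,
      TpH.map (S.autOfConj P.admissibleKer_normal_pi g).toMulEquiv.toMonoidHom = MulAut.conj t • TpH :=
  hHstab_of_mem_decompSubgroups_of_graphic X d S TpH T P hind hTpH

end Stab

/-! ### B. Cor. 2.3 (i)–(v) at `ℍ := P.H`: laws `{hA, hB}` (finite `Σ`: `{hA}`) + the datum + `hcoh`; no finiteness binder -/

section Block

variable {p : ℕ} [Fact p.Prime] (X : TemperedCurve p) (d : X.GroupLevelData)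
  (S : SpecialFibreData (X.toTemperedArithmeticGroup d)) (h36 : S.Gc.Prop36Hypotheses)
  (Sigma SigmaHat : Set ℕ) (hsub : Sigma ⊆ SigmaHat) (hne : Sigma.Nonempty)
  (hprime : ∀ q ∈ SigmaHat, q.Prime) (hp : p ∉ Sigma)
  (TpH : Subgroup S.chart.G)
  (cuspMeetsH : {x : X.Pt // X.IsCusp x} → Prop)
  (T : SpecialFibreTower X.DeltaTemp)

/-- **[IUTchI] Cor. 2.3 (i)–(v) AS TYPED at the genuine datum, print's `Π̂_ℍ`, for the record's `Π`-stable connected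
sub-semi-graph `ℍ := P.H` and EVERY `Π^tp_ℍ := TpH ∈ decompSubgroups S.chart P.H`** — binders: laws `{hA, hB}`, the origin
datum `hind : P.ActGraphInduces` BY NAME, the FACT-INSTANCE `hcoh`; the finiteness of the dual semi-graph is the record's
`P.finite`. [cite: Mochizuki2012, Cor 2.3 pp.47-50] -/
theorem cor23_i_to_v_ofSpecialFibre_closureH_of_piData_of_mem_decompSubgroups_of_actGraphInduces
    (P : SpecialFibreTower.PiData X d S T)
    (hA : (∃ l ∈ SigmaHat, l ∉ Sigma ∧ l ≠ p) →
      ∀ (i : ℕ) (a : (ofSpecialFibre X d S h36 Sigma SigmaHat hsub hne hprime hp TpH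
      ((TpH.map (TemperedGraphGroupData.exists_completion_of_prop36 S.Gc h36
        S.chart).choose_spec.choose.toMonoidHom).topologicalClosure) (Subgroup.le_topologicalClosure _) cuspMeetsH).DeltaHat),
        (∀ x ∈ ((OfSpecialFibre.towerOfSpecialFibreTower X d T Sigma SigmaHat hsub hne hprime S h36 hp TpH
        ((TpH.map (TemperedGraphGroupData.exists_completion_of_prop36 S.Gc h36
        S.chart).choose_spec.choose.toMonoidHom).topologicalClosure) (Subgroup.le_topologicalClosure _)
        cuspMeetsH).Jhat i).subgroupOf (ofSpecialFibre X d S h36 Sigma SigmaHat hsub hne hprime hp TpH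
      ((TpH.map (TemperedGraphGroupData.exists_completion_of_prop36 S.Gc h36
        S.chart).choose_spec.choose.toMonoidHom).topologicalClosure) (Subgroup.le_topologicalClosure _) cuspMeetsH).DeltaHat,
          x ∈ (ofSpecialFibre X d S h36 Sigma SigmaHat hsub hne hprime hp TpH
      ((TpH.map (TemperedGraphGroupData.exists_completion_of_prop36 S.Gc h36
        S.chart).choose_spec.choose.toMonoidHom).topologicalClosure) (Subgroup.le_topologicalClosure _) cuspMeetsH).ρHat.ker → a * x = x * a) →
        a ∈ ((OfSpecialFibre.towerOfSpecialFibreTower X d T Sigma SigmaHat hsub hne hprime S h36 hp TpH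
        ((TpH.map (TemperedGraphGroupData.exists_completion_of_prop36 S.Gc h36
        S.chart).choose_spec.choose.toMonoidHom).topologicalClosure) (Subgroup.le_topologicalClosure _)
        cuspMeetsH).Jhat i).subgroupOf (ofSpecialFibre X d S h36 Sigma SigmaHat hsub hne hprime hp TpH
      ((TpH.map (TemperedGraphGroupData.exists_completion_of_prop36 S.Gc h36
        S.chart).choose_spec.choose.toMonoidHom).topologicalClosure) (Subgroup.le_topologicalClosure _) cuspMeetsH).DeltaHat)
    (hB : SigmaHat = {q | q.Prime} →
      ∀ (i : ℕ) (a : (ofSpecialFibre X d S h36 Sigma SigmaHat hsub hne hprime hp TpH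
      ((TpH.map (TemperedGraphGroupData.exists_completion_of_prop36 S.Gc h36
        S.chart).choose_spec.choose.toMonoidHom).topologicalClosure) (Subgroup.le_topologicalClosure _) cuspMeetsH).DeltaHat),
        (∀ x ∈ ((OfSpecialFibre.towerOfSpecialFibreTower X d T Sigma SigmaHat hsub hne hprime S h36 hp TpH
        ((TpH.map (TemperedGraphGroupData.exists_completion_of_prop36 S.Gc h36
        S.chart).choose_spec.choose.toMonoidHom).topologicalClosure) (Subgroup.le_topologicalClosure _)
        cuspMeetsH).Jhat i).subgroupOf (ofSpecialFibre X d S h36 Sigma SigmaHat hsub hne hprime hp TpH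
      ((TpH.map (TemperedGraphGroupData.exists_completion_of_prop36 S.Gc h36
        S.chart).choose_spec.choose.toMonoidHom).topologicalClosure) (Subgroup.le_topologicalClosure _) cuspMeetsH).DeltaHat,
          x ∈ (ofSpecialFibre X d S h36 Sigma SigmaHat hsub hne hprime hp TpH
      ((TpH.map (TemperedGraphGroupData.exists_completion_of_prop36 S.Gc h36
        S.chart).choose_spec.choose.toMonoidHom).topologicalClosure) (Subgroup.le_topologicalClosure _) cuspMeetsH).ρHat.ker → a * x = x * a) →
        a ∈ ((OfSpecialFibre.towerOfSpecialFibreTower X d T Sigma SigmaHat hsub hne hprime S h36 hp TpH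
        ((TpH.map (TemperedGraphGroupData.exists_completion_of_prop36 S.Gc h36
        S.chart).choose_spec.choose.toMonoidHom).topologicalClosure) (Subgroup.le_topologicalClosure _)
        cuspMeetsH).Jhat i).subgroupOf (ofSpecialFibre X d S h36 Sigma SigmaHat hsub hne hprime hp TpH
      ((TpH.map (TemperedGraphGroupData.exists_completion_of_prop36 S.Gc h36
        S.chart).choose_spec.choose.toMonoidHom).topologicalClosure) (Subgroup.le_topologicalClosure _) cuspMeetsH).DeltaHat)
    (hcoh : S.Gc.IsCoherent) (hTpH : TpH ∈ S.chart.decompSubgroups P.H) (hind : P.ActGraphInduces) :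
    ((ofSpecialFibre X d S h36 Sigma SigmaHat hsub hne hprime hp TpH
      ((TpH.map (TemperedGraphGroupData.exists_completion_of_prop36 S.Gc h36
        S.chart).choose_spec.choose.toMonoidHom).topologicalClosure) (Subgroup.le_topologicalClosure _) cuspMeetsH).Cor23i ∧
      (ofSpecialFibre X d S h36 Sigma SigmaHat hsub hne hprime hp TpH
      ((TpH.map (TemperedGraphGroupData.exists_completion_of_prop36 S.Gc h36
        S.chart).choose_spec.choose.toMonoidHom).topologicalClosure) (Subgroup.le_topologicalClosure _) cuspMeetsH).Cor23ii ∧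
      (ofSpecialFibre X d S h36 Sigma SigmaHat hsub hne hprime hp TpH
      ((TpH.map (TemperedGraphGroupData.exists_completion_of_prop36 S.Gc h36
        S.chart).choose_spec.choose.toMonoidHom).topologicalClosure) (Subgroup.le_topologicalClosure _) cuspMeetsH).Cor23iii ∧
      (ofSpecialFibre X d S h36 Sigma SigmaHat hsub hne hprime hp TpH
      ((TpH.map (TemperedGraphGroupData.exists_completion_of_prop36 S.Gc h36
        S.chart).choose_spec.choose.toMonoidHom).topologicalClosure) (Subgroup.le_topologicalClosure _) cuspMeetsH).Cor23iv) ∧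
      (ofSpecialFibre X d S h36 Sigma SigmaHat hsub hne hprime hp TpH
      ((TpH.map (TemperedGraphGroupData.exists_completion_of_prop36 S.Gc h36
        S.chart).choose_spec.choose.toMonoidHom).topologicalClosure) (Subgroup.le_topologicalClosure _) cuspMeetsH).Cor23v :=
  haveI := P.finite.finite_vertex_base
  haveI := P.finite.finite_edge_base
  cor23_i_to_v_ofSpecialFibre_closureH_of_piData_of_mem_decompSubgroups_of_graphic X d S h36 Sigma SigmaHat hsub hne
    hprime hp TpH cuspMeetsH T P hA hB hcoh hTpH hind

/-- **The same for FINITE `Σ`** (the IUT case `Σ = {l}`): the (b)-law is idle — laws `{hA}` + the datum + `hcoh`.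
[cite: Mochizuki2012, Cor 2.3 pp.47-50] -/
theorem cor23_i_to_v_ofSpecialFibre_closureH_of_piData_of_mem_decompSubgroups_of_actGraphInduces_of_finite
    (P : SpecialFibreTower.PiData X d S T) (hfin : Sigma.Finite)
    (hA : (∃ l ∈ SigmaHat, l ∉ Sigma ∧ l ≠ p) →
      ∀ (i : ℕ) (a : (ofSpecialFibre X d S h36 Sigma SigmaHat hsub hne hprime hp TpH
      ((TpH.map (TemperedGraphGroupData.exists_completion_of_prop36 S.Gc h36
        S.chart).choose_spec.choose.toMonoidHom).topologicalClosure) (Subgroup.le_topologicalClosure _) cuspMeetsH).DeltaHat),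
        (∀ x ∈ ((OfSpecialFibre.towerOfSpecialFibreTower X d T Sigma SigmaHat hsub hne hprime S h36 hp TpH
        ((TpH.map (TemperedGraphGroupData.exists_completion_of_prop36 S.Gc h36
        S.chart).choose_spec.choose.toMonoidHom).topologicalClosure) (Subgroup.le_topologicalClosure _)
        cuspMeetsH).Jhat i).subgroupOf (ofSpecialFibre X d S h36 Sigma SigmaHat hsub hne hprime hp TpH
      ((TpH.map (TemperedGraphGroupData.exists_completion_of_prop36 S.Gc h36
        S.chart).choose_spec.choose.toMonoidHom).topologicalClosure) (Subgroup.le_topologicalClosure _) cuspMeetsH).DeltaHat,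
          x ∈ (ofSpecialFibre X d S h36 Sigma SigmaHat hsub hne hprime hp TpH
      ((TpH.map (TemperedGraphGroupData.exists_completion_of_prop36 S.Gc h36
        S.chart).choose_spec.choose.toMonoidHom).topologicalClosure) (Subgroup.le_topologicalClosure _) cuspMeetsH).ρHat.ker → a * x = x * a) →
        a ∈ ((OfSpecialFibre.towerOfSpecialFibreTower X d T Sigma SigmaHat hsub hne hprime S h36 hp TpH
        ((TpH.map (TemperedGraphGroupData.exists_completion_of_prop36 S.Gc h36
        S.chart).choose_spec.choose.toMonoidHom).topologicalClosure) (Subgroup.le_topologicalClosure _)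
        cuspMeetsH).Jhat i).subgroupOf (ofSpecialFibre X d S h36 Sigma SigmaHat hsub hne hprime hp TpH
      ((TpH.map (TemperedGraphGroupData.exists_completion_of_prop36 S.Gc h36
        S.chart).choose_spec.choose.toMonoidHom).topologicalClosure) (Subgroup.le_topologicalClosure _) cuspMeetsH).DeltaHat)
    (hcoh : S.Gc.IsCoherent) (hTpH : TpH ∈ S.chart.decompSubgroups P.H) (hind : P.ActGraphInduces) :
    ((ofSpecialFibre X d S h36 Sigma SigmaHat hsub hne hprime hp TpH
      ((TpH.map (TemperedGraphGroupData.exists_completion_of_prop36 S.Gc h36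
        S.chart).choose_spec.choose.toMonoidHom).topologicalClosure) (Subgroup.le_topologicalClosure _) cuspMeetsH).Cor23i ∧
      (ofSpecialFibre X d S h36 Sigma SigmaHat hsub hne hprime hp TpH
      ((TpH.map (TemperedGraphGroupData.exists_completion_of_prop36 S.Gc h36
        S.chart).choose_spec.choose.toMonoidHom).topologicalClosure) (Subgroup.le_topologicalClosure _) cuspMeetsH).Cor23ii ∧
      (ofSpecialFibre X d S h36 Sigma SigmaHat hsub hne hprime hp TpH
      ((TpH.map (TemperedGraphGroupData.exists_completion_of_prop36 S.Gc h36
        S.chart).choose_spec.choose.toMonoidHom).topologicalClosure) (Subgroup.le_topologicalClosure _) cuspMeetsH).Cor23iii ∧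
      (ofSpecialFibre X d S h36 Sigma SigmaHat hsub hne hprime hp TpH
      ((TpH.map (TemperedGraphGroupData.exists_completion_of_prop36 S.Gc h36
        S.chart).choose_spec.choose.toMonoidHom).topologicalClosure) (Subgroup.le_topologicalClosure _) cuspMeetsH).Cor23iv) ∧
      (ofSpecialFibre X d S h36 Sigma SigmaHat hsub hne hprime hp TpH
      ((TpH.map (TemperedGraphGroupData.exists_completion_of_prop36 S.Gc h36
        S.chart).choose_spec.choose.toMonoidHom).topologicalClosure) (Subgroup.le_topologicalClosure _) cuspMeetsH).Cor23v :=
  cor23_i_to_v_ofSpecialFibre_closureH_of_piData_of_mem_decompSubgroups_of_actGraphInduces X d S h36 Sigma SigmaHat hsub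
    hne hprime hp TpH cuspMeetsH T P hA
    (fun hb => hA (cor23iii_condA_of_condB (exists_prime_not_mem_of_finite hfin p) hb)) hcoh hTpH hind

end Block

end StableCurveTemperedData

end Literature.IUT.HodgeTheaters

end
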